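import Literature.Geometry.Kaehler.ComplexTorusCentralizerRosati
import Literature.Geometry.Kaehler.ComplexTorusDualPolarizationIsogeny
import HarnessLib

/-!
# `C(A)` and `Lf(X)` are isogeny invariants: `γ ↦ V(α) ∘ γ ∘ V(α)⁻¹` (Milne 1999, §1, p. 643;
# Lange 2023, §7.2.4 Exercise (4)(c), "`X ∼ …`")

Layer `Literature/Geometry/Kaehler`, namespace `Literature.Geometry.Kaehler.ComplexTorus`; lane
`lit-hodgefound` (Track 2 foundations library), Layer A4, self-proposed row A4-21⁺⁺⁺⁺⁺⁺⁺⁺ · Q155⁺⁺⁺ of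
`run/shared/lean/pub/lit-hodgefound/SKELETON.md`; sequel of `ComplexTorusLefschetzGroupProduct.lean`
(`endCentralizerAlg Φ` = Milne's `C(A)`, `k = ℝ`), `ComplexTorusLefschetzGroup.lean` (`lefschetzGroup Φ η`,
Exercise (4)(a) `IsRiemannForm.lefschetzGroup_eq`) and of the isogeny calculus of
`ComplexTorusEndomorphismAlgebraProduct.lean` (`homRat`, `mul_mem_homRat`, `IsIsogeny.map_intCast_mem_homRat`,
`IsIsogeny.exists_homRat_inverse`: an isogeny `ρ_r(f) = A` has an inverse `Q ∈ Hom_ℚ(X₂, X₁)`,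
`QA = 1 = AQ`) and `ComplexTorusDualPolarizationIsogeny.lean` (`IsIsogeny.isRiemannForm_pullbackForm`).
CONCRETE torus level, model-free: an isogeny `f : X₁ = E₁/Φ₁(ℤ^{ι₁}) → X₂ = E₂/Φ₂(ℤ^{ι₂})` is an integer
matrix `A` (`IsIsogeny Φ₁ Φ₂ A`), `V(f) = P = A_ℚ ∈ Hom_ℚ(X₁, X₂)` with inverse `V(f)⁻¹ = Q ∈ Hom_ℚ(X₂, X₁)`,
and Milne's map is `γ ↦ P γ Q` on `M_{ι₁}(ℝ) → M_{ι₂}(ℝ)`.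

Sources followed, verbatim.

* J. S. Milne, *Lefschetz classes on abelian varieties*, Duke Math. J. 96 (1999), §1, p. 643 (held
  `paper:doi-10-1215-s0012-7094-99-09620-5`, p0005 L3–L7): "An isogeny `α: A → B` defines an isomorphism
  `γ ↦ V(α) ∘ γ ∘ V(α)⁻¹ : C(A) → C(B)` of `k`-algebras with involution, which is independent of the
  choice of `α`. Therefore `C(A)`, as a `k`-algebra with involution, depends only on the isogeny class of
  `A` (up to a canonical isomorphism)."
* H. Lange, *Abelian Varieties over the Complex Numbers* (Springer 2023), §7.2.4 Exercise (4)(c), p. 334: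
  "If there is an isogeny `X ∼ X₁^{n₁} × ⋯ × X_r^{n_r}` […], then `Lf(X) ≃ Lf(X₁) × ⋯ × Lf(X_r)`" — the
  isogeny-invariance step `Lf(X) ≃ Lf(X₁^{n₁} × ⋯ × X_r^{n_r})`.

## Presentation and what is (not) formalised

For mutually inverse `P ∈ Hom_ℚ(X₁, X₂)`, `Q ∈ Hom_ℚ(X₂, X₁)` (`QP = 1`, `PQ = 1`; realified) we build
the conjugation `γ ↦ PγQ` as an `ℝ`-algebra homomorphism `conjAlgHom` and, on `SL`, as a group
homomorphism `conjSL` (`det(PγQ) = det γ`, via a reindexing `ι₁ ≃ ι₂`, `|ι₁| = |ι₂|` from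
`tr(PQ) = tr(QP)`), and prove: `C(X₂) = P C(X₁) Q` (`endCentralizerAlg_eq_map_conjAlgHom`), hence
`C(X₁) ≃ₐ C(X₂)` for isogenous tori (`IsIsogenous.nonempty_endCentralizerAlg_algEquiv`); and
`Lf(X₂, E) = P Lf(X₁, f^*E) Q` for every form `E` on `X₂` (`lefschetzGroup_eq_map_conjSL`, with
`Gram(f^*E) = ᵗP Gram(E) P`), hence for polarised abelian varieties and an isogeny `f`,
`Lf(X₂, E₂) = P Lf(X₁, E₁) Q` for ANY polarisations `E₁`, `E₂` (Exercise (4)(a)) and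
`Lf(X₁) ≃ Lf(X₂)` (`IsIsogeny.lefschetzGroup_eq_map_conjSL`, `IsIsogeny.nonempty_lefschetzGroup_mulEquiv`).
NOT formalised: the compatibility of `γ ↦ PγQ` with the involutions (it holds for `f^*E` vs `E` by the
same Gram-matrix identity; omitted), "independent of the choice of `α`", identity components.

## Contents (definitions with bodies and PROVED theorems; no named fact, net debt 0)

* §1 `card_eq_of_mul_eq_one` (`|ι₁| = |ι₂|`), `conjAlgHom`
  (`γ ↦ PγQ`), `conjAlgHom_apply`, `conjAlgHom_injective`, `det_conj` (`det(PγQ) = det γ`), `conjSL`,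
  `coe_conjSL`, `conjSL_injective`.
* §2 `conj_mem_endCentralizerAlg`, **`endCentralizerAlg_eq_map_conjAlgHom`** (Milne: `C(B) = V(α) C(A) V(α)⁻¹`),
  `IsIsogeny.exists_endCentralizerAlg_eq_map`, **`IsIsogenous.nonempty_endCentralizerAlg_algEquiv`**
  ("`C(A)` depends only on the isogeny class of `A`").
* §3 `latticeGram_pullbackForm_analyticRep`, `conj_mem_lefschetzGroup`, **`lefschetzGroup_eq_map_conjSL`**,
  **`IsIsogeny.lefschetzGroup_eq_map_conjSL`** (any polarisations), **`IsIsogeny.nonempty_lefschetzGroup_mulEquiv`**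
  (`Lf` is an isogeny invariant — the "`X ∼`" of Exercise (4)(c)).

## References

* [Milne1999LefschetzClasses] J. S. Milne, *Lefschetz classes on abelian varieties*, Duke Math. J. 96
  (1999), 639–675, §1 (p. 643).
* [Lange2023AbelianVarietiesComplex] H. Lange, *Abelian Varieties over the Complex Numbers*, Grundlehren
  Text Editions, Springer (2023), §7.2.4 Exercise (4)(a), (c); §1.1.2 Prop. 1.1.15, Cor. 1.1.16 (isogenies
  are invertible in `Hom_ℚ`).
-/

noncomputable section

open scoped Real
open Set Function Complex Module Matrix

namespace Literature.Geometry.Kaehler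

namespace ComplexTorus

/-! ## §1 Conjugation `γ ↦ P γ Q` by mutually inverse rational homomorphisms -/

section Conj

variable {ι₁ ι₂ : Type*} [Fintype ι₁] [Fintype ι₂] [DecidableEq ι₁] [DecidableEq ι₂]

omit [Fintype ι₁] [DecidableEq ι₂] in
/-- Realification of `Q P = 1`. [folklore] -/
private theorem map_ratCast_mul_eq_one {Q : Matrix ι₁ ι₂ ℚ} {P : Matrix ι₂ ι₁ ℚ} (hQP : Q * P = 1) :
    Q.map (Rat.cast : ℚ → ℝ) * P.map (Rat.cast : ℚ → ℝ) = 1 := by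
  have h : (Q * P).map (Rat.cast : ℚ → ℝ) = Q.map (Rat.cast : ℚ → ℝ) * P.map (Rat.cast : ℚ → ℝ) :=
    Matrix.map_mul (f := Rat.castHom ℝ)
  rw [← h, hQP, Matrix.map_one Rat.cast Rat.cast_zero Rat.cast_one]

/-- Mutually inverse rectangular matrices have index types of the same size (`tr(PQ) = tr(QP)`), so that
`V(A) ≅ V(B)` for isogenous `A`, `B`. [cite: Lange2023AbelianVarietiesComplex, §1.1.2 Cor. 1.1.16 (isogenous tori have the same dimension)] -/
theorem card_eq_of_mul_eq_one {R : Type*} [CommRing R] [CharZero R] {P : Matrix ι₂ ι₁ R} {Q : Matrix ι₁ ι₂ R}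
    (hQP : Q * P = 1) (hPQ : P * Q = 1) : Fintype.card ι₁ = Fintype.card ι₂ := by
  have h := Matrix.trace_mul_comm P Q
  rw [hPQ, hQP, Matrix.trace_one, Matrix.trace_one] at h
  exact_mod_cast h.symm

/-- **Milne's map `γ ↦ V(α) ∘ γ ∘ V(α)⁻¹`** for mutually inverse `P : V₁ → V₂`, `Q : V₂ → V₁` (real
matrices, `QP = 1`, `PQ = 1`): the `ℝ`-algebra homomorphism `M_{ι₁}(ℝ) → M_{ι₂}(ℝ)`, `γ ↦ P γ Q`.
[cite: Milne1999LefschetzClasses, §1 (p. 643)] -/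
def conjAlgHom (P : Matrix ι₂ ι₁ ℝ) (Q : Matrix ι₁ ι₂ ℝ) (hQP : Q * P = 1) (hPQ : P * Q = 1) :
    Matrix ι₁ ι₁ ℝ →ₐ[ℝ] Matrix ι₂ ι₂ ℝ where
  toFun M := P * M * Q
  map_one' := by rw [Matrix.mul_one, hPQ]
  map_mul' M N := by
    calc P * (M * N) * Q = P * M * (Q * P) * N * Q := by
          rw [hQP, Matrix.mul_one]; simp only [Matrix.mul_assoc]
      _ = P * M * Q * (P * N * Q) := by simp only [Matrix.mul_assoc]
  map_zero' := by rw [Matrix.mul_zero, Matrix.zero_mul]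
  map_add' M N := by rw [Matrix.mul_add, Matrix.add_mul]
  commutes' r := by
    rw [Algebra.algebraMap_eq_smul_one, Algebra.algebraMap_eq_smul_one, Matrix.mul_smul, Matrix.mul_one,
      Matrix.smul_mul, hPQ]

/-- `conjAlgHom P Q _ _ γ = P γ Q`. [cite: Milne1999LefschetzClasses, §1 (p. 643)] -/
@[simp] theorem conjAlgHom_apply (P : Matrix ι₂ ι₁ ℝ) (Q : Matrix ι₁ ι₂ ℝ) (hQP : Q * P = 1)
    (hPQ : P * Q = 1) (M : Matrix ι₁ ι₁ ℝ) : conjAlgHom P Q hQP hPQ M = P * M * Q :=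
  rfl

/-- `γ ↦ PγQ` is injective (left inverse `δ ↦ QδP`). [cite: Milne1999LefschetzClasses, §1 (p. 643: "an isomorphism")] -/
theorem conjAlgHom_injective (P : Matrix ι₂ ι₁ ℝ) (Q : Matrix ι₁ ι₂ ℝ) (hQP : Q * P = 1)
    (hPQ : P * Q = 1) : Injective (conjAlgHom P Q hQP hPQ) := by
  intro M N h
  rw [conjAlgHom_apply, conjAlgHom_apply] at h
  have h' := congrArg (fun X ↦ Q * X * P) h
  simpa only [Matrix.mul_assoc, hQP, Matrix.mul_one, ← Matrix.mul_assoc Q P, Matrix.one_mul] using h'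

/-- **`det(P γ Q) = det γ`** for mutually inverse `P`, `Q` (reindex along `ι₁ ≃ ι₂` and use `det(PQ) = 1`).
[cite: Milne1999LefschetzClasses, §1 (p. 643)] -/
theorem det_conj (P : Matrix ι₂ ι₁ ℝ) (Q : Matrix ι₁ ι₂ ℝ) (hQP : Q * P = 1) (hPQ : P * Q = 1)
    (M : Matrix ι₁ ι₁ ℝ) : (P * M * Q).det = M.det := by
  obtain ⟨e⟩ : Nonempty (ι₁ ≃ ι₂) := Fintype.card_eq.1 (card_eq_of_mul_eq_one hQP hPQ)
  have hPe : (P * M * Q).submatrix e e = P.submatrix e id * M * Q.submatrix id e := by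
    rw [← Matrix.submatrix_mul_equiv (P * M) Q (⇑e) (Equiv.refl ι₁) (⇑e),
      ← Matrix.submatrix_mul_equiv P M (⇑e) (Equiv.refl ι₁) (⇑(Equiv.refl ι₁)), Equiv.coe_refl,
      Matrix.submatrix_id_id]
  have hPQe : P.submatrix e id * Q.submatrix id e = 1 := by
    rw [← Equiv.coe_refl (α := ι₁), Matrix.submatrix_mul_equiv P Q (⇑e) (Equiv.refl ι₁) (⇑e), hPQ,
      Matrix.submatrix_one_equiv]
  have hdet : (P.submatrix e id).det * (Q.submatrix id e).det = 1 := by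
    rw [← Matrix.det_mul, hPQe, Matrix.det_one]
  rw [← Matrix.det_submatrix_equiv_self e, hPe, Matrix.det_mul, Matrix.det_mul, mul_comm (P.submatrix e id).det,
    mul_assoc, hdet, mul_one]

/-- **`γ ↦ V(α) γ V(α)⁻¹` on `SL`**: the group homomorphism `SL(V₁) → SL(V₂)`, `γ ↦ P γ Q`.
[cite: Milne1999LefschetzClasses, §1 (p. 643)] [cite: Lange2023AbelianVarietiesComplex, §7.2.4 Exercise (4)(c)] -/
def conjSL (P : Matrix ι₂ ι₁ ℝ) (Q : Matrix ι₁ ι₂ ℝ) (hQP : Q * P = 1) (hPQ : P * Q = 1) :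
    SpecialLinearGroup ι₁ ℝ →* SpecialLinearGroup ι₂ ℝ where
  toFun M := ⟨P * M.1 * Q, by rw [det_conj P Q hQP hPQ, M.2]⟩
  map_one' := Subtype.ext (by
    change P * (1 : Matrix ι₁ ι₁ ℝ) * Q = 1
    rw [Matrix.mul_one, hPQ])
  map_mul' M N := Subtype.ext (by
    change P * (M.1 * N.1) * Q = P * M.1 * Q * (P * N.1 * Q)
    exact map_mul (conjAlgHom P Q hQP hPQ) M.1 N.1)

/-- The matrix of `conjSL P Q _ _ γ` is `P γ Q`. [cite: Milne1999LefschetzClasses, §1 (p. 643)] -/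
@[simp] theorem coe_conjSL (P : Matrix ι₂ ι₁ ℝ) (Q : Matrix ι₁ ι₂ ℝ) (hQP : Q * P = 1) (hPQ : P * Q = 1)
    (M : SpecialLinearGroup ι₁ ℝ) : (conjSL P Q hQP hPQ M : Matrix ι₂ ι₂ ℝ) = P * M.1 * Q :=
  rfl

/-- `conjSL` is injective. [cite: Milne1999LefschetzClasses, §1 (p. 643)] -/
theorem conjSL_injective (P : Matrix ι₂ ι₁ ℝ) (Q : Matrix ι₁ ι₂ ℝ) (hQP : Q * P = 1) (hPQ : P * Q = 1) :
    Injective (conjSL P Q hQP hPQ) := fun _ _ h ↦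
  Subtype.ext (conjAlgHom_injective P Q hQP hPQ (congrArg (fun X : SpecialLinearGroup ι₂ ℝ ↦ X.1) h))

end Conj

/-! ## §2 `C(B) = V(α) C(A) V(α)⁻¹` -/

section Centralizer

variable {ι₁ ι₂ : Type*} [Fintype ι₁] [Fintype ι₂] [DecidableEq ι₁] [DecidableEq ι₂]
  {E₁ E₂ : Type*} [NormedAddCommGroup E₁] [NormedSpace ℂ E₁] [NormedAddCommGroup E₂] [NormedSpace ℂ E₂]
  {Φ₁ : (ι₁ → ℝ) ≃L[ℝ] E₁} {Φ₂ : (ι₂ → ℝ) ≃L[ℝ] E₂}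

omit [Fintype ι₁] [DecidableEq ι₁] [DecidableEq ι₂] in
/-- Realification is multiplicative (rectangular). [folklore] -/
private theorem map_ratCast_mul₃ {κ : Type*} (A : Matrix ι₁ ι₂ ℚ) (B : Matrix ι₂ κ ℚ) :
    (A * B).map (Rat.cast : ℚ → ℝ) = A.map (Rat.cast : ℚ → ℝ) * B.map (Rat.cast : ℚ → ℝ) :=
  Matrix.map_mul (f := Rat.castHom ℝ)

/-- **`V(α) γ V(α)⁻¹ ∈ C(B)` for `γ ∈ C(A)`**: for `P ∈ Hom_ℚ(X₁, X₂)`, `Q ∈ Hom_ℚ(X₂, X₁)` mutually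
inverse and `γ` centralising `End_ℚ(X₁)`, `PγQ` centralises `End_ℚ(X₂)` (since `Q φ P ∈ End_ℚ(X₁)` for
`φ ∈ End_ℚ(X₂)`). [cite: Milne1999LefschetzClasses, §1 (p. 643)] -/
theorem conj_mem_endCentralizerAlg {P : Matrix ι₂ ι₁ ℚ} {Q : Matrix ι₁ ι₂ ℚ} (hP : P ∈ homRat Φ₁ Φ₂)
    (hQ : Q ∈ homRat Φ₂ Φ₁) (hPQ : P * Q = 1) {M : Matrix ι₁ ι₁ ℝ} (hM : M ∈ endCentralizerAlg Φ₁) :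
    P.map (Rat.cast : ℚ → ℝ) * M * Q.map (Rat.cast : ℚ → ℝ) ∈ endCentralizerAlg Φ₂ := by
  set Pr := P.map (Rat.cast : ℚ → ℝ)
  set Qr := Q.map (Rat.cast : ℚ → ℝ)
  have hPQr : Pr * Qr = 1 := map_ratCast_mul_eq_one hPQ
  rw [mem_endCentralizerAlg_iff] at hM ⊢
  intro N hN
  -- `Q N P ∈ End_ℚ(X₁)` commutes with `M`
  have hN' : Q * N * P ∈ endAlgRat Φ₁ :=
    (mem_endAlgRat_iff Φ₁ _).2 ((mem_homRat_iff Φ₁ Φ₁ _).1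
      (mul_mem_homRat Φ₁ Φ₂ Φ₁ (mul_mem_homRat Φ₂ Φ₂ Φ₁ hQ ((mem_homRat_iff Φ₂ Φ₂ N).2
        ((mem_endAlgRat_iff Φ₂ N).1 hN))) hP))
  have hc := hM _ hN'
  rw [map_ratCast_mul₃, map_ratCast_mul₃] at hc
  -- `hc : M * (Qr * Nr * Pr) = Qr * Nr * Pr * M`
  calc Pr * M * Qr * N.map (Rat.cast : ℚ → ℝ)
      = Pr * M * Qr * N.map (Rat.cast : ℚ → ℝ) * (Pr * Qr) := by rw [hPQr, Matrix.mul_one]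
    _ = Pr * (M * (Qr * N.map (Rat.cast : ℚ → ℝ) * Pr)) * Qr := by simp only [Matrix.mul_assoc]
    _ = Pr * (Qr * N.map (Rat.cast : ℚ → ℝ) * Pr * M) * Qr := by rw [hc]
    _ = Pr * Qr * (N.map (Rat.cast : ℚ → ℝ) * (Pr * M * Qr)) := by simp only [Matrix.mul_assoc]
    _ = N.map (Rat.cast : ℚ → ℝ) * (Pr * M * Qr) := by rw [hPQr, Matrix.one_mul]

/-- **Milne 1999, §1: "An isogeny `α: A → B` defines an isomorphism `γ ↦ V(α) ∘ γ ∘ V(α)⁻¹ : C(A) → C(B)`"**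
— at torus level, `k = ℝ`: for mutually inverse `P ∈ Hom_ℚ(X₁, X₂)`, `Q ∈ Hom_ℚ(X₂, X₁)`,
`C(X₂) = P · C(X₁) · Q`. [cite: Milne1999LefschetzClasses, §1 (p. 643)] -/
theorem endCentralizerAlg_eq_map_conjAlgHom {P : Matrix ι₂ ι₁ ℚ} {Q : Matrix ι₁ ι₂ ℚ}
    (hP : P ∈ homRat Φ₁ Φ₂) (hQ : Q ∈ homRat Φ₂ Φ₁) (hQP : Q * P = 1) (hPQ : P * Q = 1) :
    endCentralizerAlg Φ₂ = (endCentralizerAlg Φ₁).map (conjAlgHom (P.map (Rat.cast : ℚ → ℝ))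
      (Q.map (Rat.cast : ℚ → ℝ)) (map_ratCast_mul_eq_one hQP) (map_ratCast_mul_eq_one hPQ)) := by
  have hQPr := map_ratCast_mul_eq_one hQP
  have hPQr := map_ratCast_mul_eq_one hPQ
  refine le_antisymm ?_ ?_
  · intro N hN
    refine Subalgebra.mem_map.2 ⟨Q.map (Rat.cast : ℚ → ℝ) * N * P.map (Rat.cast : ℚ → ℝ),
      conj_mem_endCentralizerAlg hQ hP hQP hN, ?_⟩
    rw [conjAlgHom_apply]
    calc P.map (Rat.cast : ℚ → ℝ) * (Q.map (Rat.cast : ℚ → ℝ) * N * P.map (Rat.cast : ℚ → ℝ)) *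
          Q.map (Rat.cast : ℚ → ℝ)
        = P.map (Rat.cast : ℚ → ℝ) * Q.map (Rat.cast : ℚ → ℝ) * N *
            (P.map (Rat.cast : ℚ → ℝ) * Q.map (Rat.cast : ℚ → ℝ)) := by simp only [Matrix.mul_assoc]
      _ = N := by rw [hPQr, Matrix.one_mul, Matrix.mul_one]
  · rintro N hN
    obtain ⟨M, hM, rfl⟩ := Subalgebra.mem_map.1 hN
    exact conj_mem_endCentralizerAlg hP hQ hPQ hM

/-- For an isogeny `f : X₁ → X₂` (integer matrix `A`), `C(X₂) = A · C(X₁) · A⁻¹` with `A⁻¹ ∈ Hom_ℚ(X₂, X₁)`.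
[cite: Milne1999LefschetzClasses, §1 (p. 643)] [cite: Lange2023AbelianVarietiesComplex, §1.1.2 Prop. 1.1.15] -/
theorem IsIsogeny.exists_endCentralizerAlg_eq_map {A : Matrix ι₂ ι₁ ℤ} (hA : IsIsogeny Φ₁ Φ₂ A) :
    ∃ (Q : Matrix ι₁ ι₂ ℚ) (hQP : Q * A.map (Int.cast : ℤ → ℚ) = 1) (hPQ : A.map (Int.cast : ℤ → ℚ) * Q = 1),
      Q ∈ homRat Φ₂ Φ₁ ∧ endCentralizerAlg Φ₂ = (endCentralizerAlg Φ₁).map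
        (conjAlgHom ((A.map (Int.cast : ℤ → ℚ)).map (Rat.cast : ℚ → ℝ)) (Q.map (Rat.cast : ℚ → ℝ))
          (map_ratCast_mul_eq_one hQP) (map_ratCast_mul_eq_one hPQ)) := by
  obtain ⟨Q, hQ, hQP, hPQ⟩ := hA.exists_homRat_inverse
  exact ⟨Q, hQP, hPQ, hQ, endCentralizerAlg_eq_map_conjAlgHom hA.map_intCast_mem_homRat hQ hQP hPQ⟩

/-- **Milne 1999, §1: "`C(A)`, as a `k`-algebra […], depends only on the isogeny class of `A`"** — at torus
level, `k = ℝ`: isogenous complex tori have isomorphic centraliser algebras `C(X₁) ≃ₐ[ℝ] C(X₂)`.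
[cite: Milne1999LefschetzClasses, §1 (p. 643)] -/
theorem IsIsogenous.nonempty_endCentralizerAlg_algEquiv (h : IsIsogenous Φ₁ Φ₂) :
    Nonempty (endCentralizerAlg Φ₁ ≃ₐ[ℝ] endCentralizerAlg Φ₂) := by
  obtain ⟨A, hA⟩ := h
  obtain ⟨Q, hQP, hPQ, -, heq⟩ := hA.exists_endCentralizerAlg_eq_map
  exact ⟨((endCentralizerAlg Φ₁).equivMapOfInjective _ (conjAlgHom_injective _ _ _ _)).trans
    (Subalgebra.equivOfEq _ _ heq.symm)⟩

end Centralizer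

/-! ## §3 `Lf(X₂, E) = V(f) · Lf(X₁, f^*E) · V(f)⁻¹`: the Lefschetz group is an isogeny invariant -/

section Lefschetz

variable {ι₁ ι₂ : Type*} [Fintype ι₁] [Fintype ι₂] [DecidableEq ι₁] [DecidableEq ι₂]
  {E₁ E₂ : Type*} [NormedAddCommGroup E₁] [NormedSpace ℂ E₁] [NormedAddCommGroup E₂] [NormedSpace ℂ E₂]
  {Φ₁ : (ι₁ → ℝ) ≃L[ℝ] E₁} {Φ₂ : (ι₂ → ℝ) ≃L[ℝ] E₂}

/-- The rational homomorphism `P ∈ Hom_ℚ(X₁, X₂)` realified intertwines the complex structures. [cite: Lange2023AbelianVarietiesComplex, §1.1.2 Prop. 1.1.6] -/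
theorem map_ratCast_mul_jMatrix_of_mem_homRat {P : Matrix ι₂ ι₁ ℚ} (hP : P ∈ homRat Φ₁ Φ₂) :
    P.map (Rat.cast : ℚ → ℝ) * jMatrix Φ₁ = jMatrix Φ₂ * P.map (Rat.cast : ℚ → ℝ) :=
  (mem_homRat_iff Φ₁ Φ₂ P).1 hP

/-- **`Gram(f^*E) = ᵗP · Gram(E) · P`** for the analytic representation `f = ρ_a(P)` of `P ∈ Hom_ℚ(X₁, X₂)`.
[cite: Lange2023AbelianVarietiesComplex, §1.4.2 Prop. 1.4.6 (d)] -/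
theorem latticeGram_pullbackForm_analyticRep {P : Matrix ι₂ ι₁ ℚ} (hP : P ∈ homRat Φ₁ Φ₂)
    (η : E₂ [⋀^Fin 2]→L[ℝ] ℝ) :
    latticeGram Φ₁ (pullbackForm (analyticRep Φ₁ Φ₂ _ (map_ratCast_mul_jMatrix_of_mem_homRat hP)) η) =
      (P.map (Rat.cast : ℚ → ℝ))ᵀ * latticeGram Φ₂ η * P.map (Rat.cast : ℚ → ℝ) :=
  latticeGram_pullbackForm_of_real Φ₂ Φ₁ _ (fun y ↦ (analyticRep_apply Φ₁ Φ₂ _ y).symm) η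

/-- **`V(f) γ V(f)⁻¹ ∈ Lf(X₂, E)` for `γ ∈ Lf(X₁, f^*E)`**: `ᵗ(PγQ) G (PγQ) = ᵗQ ᵗγ (ᵗP G P) γ Q = ᵗQ ᵗP G P Q = G`
and `PγQ` centralises `End_ℚ(X₂)`. [cite: Lange2023AbelianVarietiesComplex, §7.2.4 Exercise (4)(c)]
[cite: Milne1999LefschetzClasses, §1 (p. 643)] -/
theorem conj_mem_lefschetzGroup {P : Matrix ι₂ ι₁ ℚ} {Q : Matrix ι₁ ι₂ ℚ} (hP : P ∈ homRat Φ₁ Φ₂)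
    (hQ : Q ∈ homRat Φ₂ Φ₁) (hQP : Q * P = 1) (hPQ : P * Q = 1) (η : E₂ [⋀^Fin 2]→L[ℝ] ℝ)
    {M : SpecialLinearGroup ι₁ ℝ}
    (hM : M ∈ lefschetzGroup Φ₁ (pullbackForm (analyticRep Φ₁ Φ₂ _ (map_ratCast_mul_jMatrix_of_mem_homRat hP)) η)) :
    conjSL (P.map (Rat.cast : ℚ → ℝ)) (Q.map (Rat.cast : ℚ → ℝ)) (map_ratCast_mul_eq_one hQP)
      (map_ratCast_mul_eq_one hPQ) M ∈ lefschetzGroup Φ₂ η := by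
  rw [mem_lefschetzGroup_iff, mem_spGroup_iff_latticeGram, latticeGram_pullbackForm_analyticRep hP] at hM
  obtain ⟨hsp, hc⟩ := hM
  have hPQr : P.map (Rat.cast : ℚ → ℝ) * Q.map (Rat.cast : ℚ → ℝ) = 1 := map_ratCast_mul_eq_one hPQ
  rw [mem_lefschetzGroup_iff, mem_spGroup_iff_latticeGram, coe_conjSL]
  refine ⟨?_, (mem_endCentralizerAlg_iff Φ₂).1
    (conj_mem_endCentralizerAlg hP hQ hPQ ((mem_endCentralizerAlg_iff Φ₁).2 hc))⟩
  calc (P.map (Rat.cast : ℚ → ℝ) * M.1 * Q.map (Rat.cast : ℚ → ℝ))ᵀ * latticeGram Φ₂ η *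
        (P.map (Rat.cast : ℚ → ℝ) * M.1 * Q.map (Rat.cast : ℚ → ℝ))
      = (Q.map (Rat.cast : ℚ → ℝ))ᵀ * (M.1ᵀ * ((P.map (Rat.cast : ℚ → ℝ))ᵀ * latticeGram Φ₂ η *
          P.map (Rat.cast : ℚ → ℝ)) * M.1) * Q.map (Rat.cast : ℚ → ℝ) := by
        rw [Matrix.transpose_mul, Matrix.transpose_mul]
        simp only [Matrix.mul_assoc]
    _ = (Q.map (Rat.cast : ℚ → ℝ))ᵀ * (P.map (Rat.cast : ℚ → ℝ))ᵀ * latticeGram Φ₂ η *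
          (P.map (Rat.cast : ℚ → ℝ) * Q.map (Rat.cast : ℚ → ℝ)) := by
        rw [hsp]; simp only [Matrix.mul_assoc]
    _ = latticeGram Φ₂ η := by
        rw [← Matrix.transpose_mul, hPQr, Matrix.transpose_one, Matrix.one_mul, Matrix.mul_one]

/-- **`Lf(X₂, E) = V(f) · Lf(X₁, f^*E) · V(f)⁻¹`** (real points of the centralisers in `Sp`) for mutually
inverse `P ∈ Hom_ℚ(X₁, X₂)`, `Q ∈ Hom_ℚ(X₂, X₁)` and any `2`-form `E` on `X₂`, `f = ρ_a(P)`.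
[cite: Lange2023AbelianVarietiesComplex, §7.2.4 Exercise (4)(c)] [cite: Milne1999LefschetzClasses, §1 (p. 643)] -/
theorem lefschetzGroup_eq_map_conjSL {P : Matrix ι₂ ι₁ ℚ} {Q : Matrix ι₁ ι₂ ℚ} (hP : P ∈ homRat Φ₁ Φ₂)
    (hQ : Q ∈ homRat Φ₂ Φ₁) (hQP : Q * P = 1) (hPQ : P * Q = 1) (η : E₂ [⋀^Fin 2]→L[ℝ] ℝ) :
    lefschetzGroup Φ₂ η =
      (lefschetzGroup Φ₁ (pullbackForm (analyticRep Φ₁ Φ₂ _ (map_ratCast_mul_jMatrix_of_mem_homRat hP)) η)).map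
        (conjSL (P.map (Rat.cast : ℚ → ℝ)) (Q.map (Rat.cast : ℚ → ℝ)) (map_ratCast_mul_eq_one hQP)
          (map_ratCast_mul_eq_one hPQ)) := by
  have hQPr : Q.map (Rat.cast : ℚ → ℝ) * P.map (Rat.cast : ℚ → ℝ) = 1 := map_ratCast_mul_eq_one hQP
  have hPQr : P.map (Rat.cast : ℚ → ℝ) * Q.map (Rat.cast : ℚ → ℝ) = 1 := map_ratCast_mul_eq_one hPQ
  refine le_antisymm ?_ ?_
  · intro N hN
    -- `Q N P ∈ Lf(X₁, f^*E)` and `N = P (Q N P) Q`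
    have hN' : conjSL (Q.map (Rat.cast : ℚ → ℝ)) (P.map (Rat.cast : ℚ → ℝ)) hPQr hQPr N ∈
        lefschetzGroup Φ₁ (pullbackForm (analyticRep Φ₁ Φ₂ _ (map_ratCast_mul_jMatrix_of_mem_homRat hP)) η) := by
      rw [mem_lefschetzGroup_iff, mem_spGroup_iff_latticeGram] at hN
      obtain ⟨hsp, hc⟩ := hN
      rw [mem_lefschetzGroup_iff, mem_spGroup_iff_latticeGram, latticeGram_pullbackForm_analyticRep hP,
        coe_conjSL]
      refine ⟨?_, (mem_endCentralizerAlg_iff Φ₁).1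
        (conj_mem_endCentralizerAlg hQ hP hQP ((mem_endCentralizerAlg_iff Φ₂).2 hc))⟩
      calc (Q.map (Rat.cast : ℚ → ℝ) * N.1 * P.map (Rat.cast : ℚ → ℝ))ᵀ *
            ((P.map (Rat.cast : ℚ → ℝ))ᵀ * latticeGram Φ₂ η * P.map (Rat.cast : ℚ → ℝ)) *
            (Q.map (Rat.cast : ℚ → ℝ) * N.1 * P.map (Rat.cast : ℚ → ℝ))
          = (P.map (Rat.cast : ℚ → ℝ))ᵀ * (N.1ᵀ *
              ((P.map (Rat.cast : ℚ → ℝ) * Q.map (Rat.cast : ℚ → ℝ))ᵀ * latticeGram Φ₂ η *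
                (P.map (Rat.cast : ℚ → ℝ) * Q.map (Rat.cast : ℚ → ℝ))) * N.1) * P.map (Rat.cast : ℚ → ℝ) := by
            rw [Matrix.transpose_mul, Matrix.transpose_mul, Matrix.transpose_mul]
            simp only [Matrix.mul_assoc]
        _ = (P.map (Rat.cast : ℚ → ℝ))ᵀ * latticeGram Φ₂ η * P.map (Rat.cast : ℚ → ℝ) := by
            rw [hPQr, Matrix.transpose_one, Matrix.one_mul, Matrix.mul_one, hsp, Matrix.mul_assoc]
    refine Subgroup.mem_map.2 ⟨_, hN', Subtype.ext ?_⟩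
    rw [coe_conjSL, coe_conjSL]
    calc P.map (Rat.cast : ℚ → ℝ) * (Q.map (Rat.cast : ℚ → ℝ) * N.1 * P.map (Rat.cast : ℚ → ℝ)) *
          Q.map (Rat.cast : ℚ → ℝ)
        = P.map (Rat.cast : ℚ → ℝ) * Q.map (Rat.cast : ℚ → ℝ) * N.1 *
            (P.map (Rat.cast : ℚ → ℝ) * Q.map (Rat.cast : ℚ → ℝ)) := by simp only [Matrix.mul_assoc]
      _ = N.1 := by rw [hPQr, Matrix.one_mul, Matrix.mul_one]
  · rintro N hN
    obtain ⟨M, hM, rfl⟩ := Subgroup.mem_map.1 hN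
    exact conj_mem_lefschetzGroup hP hQ hQP hPQ η hM

/-- **Exercise 7.2.4 (4)(c), the isogeny step: `Lf(X₂, E₂) = V(f) · Lf(X₁, E₁) · V(f)⁻¹` for an isogeny
`f : X₁ → X₂` of abelian varieties and ANY polarisations `E₁` of `X₁`, `E₂` of `X₂`** (by Exercise (4)(a),
`Lf(X₁, E₁) = Lf(X₁, f^*E₂)`, `f^*E₂` being a polarisation). [cite: Lange2023AbelianVarietiesComplex, §7.2.4 Exercise (4)(a), (c)]
[cite: Milne1999LefschetzClasses, §1 (p. 643)] -/
theorem IsIsogeny.lefschetzGroup_eq_map_conjSL {A : Matrix ι₂ ι₁ ℤ} (hA : IsIsogeny Φ₁ Φ₂ A)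
    {η₁ : E₁ [⋀^Fin 2]→L[ℝ] ℝ} {η₂ : E₂ [⋀^Fin 2]→L[ℝ] ℝ} (hη₁ : IsRiemannForm Φ₁ η₁)
    (hη₂ : IsRiemannForm Φ₂ η₂) {Q : Matrix ι₁ ι₂ ℚ} (hQ : Q ∈ homRat Φ₂ Φ₁)
    (hQP : Q * A.map (Int.cast : ℤ → ℚ) = 1) (hPQ : A.map (Int.cast : ℤ → ℚ) * Q = 1) :
    lefschetzGroup Φ₂ η₂ = (lefschetzGroup Φ₁ η₁).map
      (conjSL ((A.map (Int.cast : ℤ → ℚ)).map (Rat.cast : ℚ → ℝ)) (Q.map (Rat.cast : ℚ → ℝ))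
        (map_ratCast_mul_eq_one hQP) (map_ratCast_mul_eq_one hPQ)) := by
  have hP := hA.map_intCast_mem_homRat
  have hAr : (A.map (Int.cast : ℤ → ℚ)).map (Rat.cast : ℚ → ℝ) = A.map (Int.cast : ℤ → ℝ) := by
    rw [Matrix.map_map]
    exact congrArg A.map (funext fun z ↦ Rat.cast_intCast z)
  have hF : ∀ y, Φ₂ ((A.map (Int.cast : ℤ → ℝ)) *ᵥ y) =
      analyticRep Φ₁ Φ₂ _ (map_ratCast_mul_jMatrix_of_mem_homRat hP) (Φ₁ y) := by
    intro y
    rw [← hAr]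
    exact (analyticRep_apply Φ₁ Φ₂ (map_ratCast_mul_jMatrix_of_mem_homRat hP) y).symm
  have hpull : IsRiemannForm Φ₁
      (pullbackForm (analyticRep Φ₁ Φ₂ _ (map_ratCast_mul_jMatrix_of_mem_homRat hP)) η₂) :=
    hA.isRiemannForm_pullbackForm Φ₂ Φ₁ hF hη₂
  rw [ComplexTorus.lefschetzGroup_eq_map_conjSL hP hQ hQP hPQ η₂, hpull.lefschetzGroup_eq hη₁]

/-- **The Lefschetz group is an isogeny invariant: `Lf(X₁) ≃ Lf(X₂)` for isogenous polarised abelian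
varieties** (real points of the centralisers of `End_ℚ` in `Sp`, any polarisations) — the "`X ∼`" in
Exercise 7.2.4 (4)(c). [cite: Lange2023AbelianVarietiesComplex, §7.2.4 Exercise (4)(c)] [cite: Milne1999LefschetzClasses, §1 (p. 643)] -/
theorem IsIsogeny.nonempty_lefschetzGroup_mulEquiv {A : Matrix ι₂ ι₁ ℤ} (hA : IsIsogeny Φ₁ Φ₂ A)
    {η₁ : E₁ [⋀^Fin 2]→L[ℝ] ℝ} {η₂ : E₂ [⋀^Fin 2]→L[ℝ] ℝ} (hη₁ : IsRiemannForm Φ₁ η₁)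
    (hη₂ : IsRiemannForm Φ₂ η₂) : Nonempty (lefschetzGroup Φ₁ η₁ ≃* lefschetzGroup Φ₂ η₂) := by
  obtain ⟨Q, hQ, hQP, hPQ⟩ := hA.exists_homRat_inverse
  have heq := hA.lefschetzGroup_eq_map_conjSL hη₁ hη₂ hQ hQP hPQ
  exact ⟨((lefschetzGroup Φ₁ η₁).equivMapOfInjective _ (conjSL_injective _ _ _ _)).trans
    (MulEquiv.subgroupCongr heq.symm)⟩

/-- The same for `IsIsogenous` abelian varieties with chosen polarisations. [cite: Lange2023AbelianVarietiesComplex, §7.2.4 Exercise (4)(c)] -/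
theorem IsIsogenous.nonempty_lefschetzGroup_mulEquiv (h : IsIsogenous Φ₁ Φ₂)
    {η₁ : E₁ [⋀^Fin 2]→L[ℝ] ℝ} {η₂ : E₂ [⋀^Fin 2]→L[ℝ] ℝ} (hη₁ : IsRiemannForm Φ₁ η₁)
    (hη₂ : IsRiemannForm Φ₂ η₂) : Nonempty (lefschetzGroup Φ₁ η₁ ≃* lefschetzGroup Φ₂ η₂) := by
  obtain ⟨A, hA⟩ := h
  exact hA.nonempty_lefschetzGroup_mulEquiv hη₁ hη₂

end Lefschetz

end ComplexTorus

end Literature.Geometry.Kaehler
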